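import Literature.Analysis.FluidPDE.OseenHeatLpBounds
import Literature.Analysis.FluidPDE.OseenHeatWeakDiv
import Literature.Analysis.FluidPDE.WeakGradientIBP
import HarnessLib

/-!
# The Oseen–heat operator tested against divergence-free fields: `⟨e^{τΔ}P∇·F, φ⟩ = -⟨F, ∇e^{τΔ}φ⟩`

Analysis/FluidPDE support file for Kato's `L³` theory of mild solutions (Kato 1984, Thm. 1;
Lemarié-Rieusset 2016, Thm. 7.5), layer "integral form ⇒ duality form" of the programme
discharging `kato_local_L3` (`MildL3Smooth.lean`) and `kato_solution_le_div_sqrt`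
(`RusinSverakLeraySolutions.lean`). The tree's duality-form (very weak) mild solutions
(`IsMildNSSolutionFrom`, Fabes–Jones–Rivière 1972, Thm. 2.1) are tested against smooth compactly
supported divergence-free fields `φ`, the nonlinear term appearing as
`∫₀ᵗ ∫ ⟪u(s), (u(s)·∇) e^{ν(t-s)Δ}φ⟫ ds`; Kato's solution is built from the Oseen–heat operator
`𝒩_τ F = e^{τΔ}P∇·F` of `OseenHeat.lean`,
`(𝒩_τ F)ᵢ = ∑ⱼ ∂ⱼ e^{τΔ} Fⱼᵢ + ∑ⱼₖ ∫₀^∞ ∂ᵢ∂ⱼ∂ₖ e^{(τ+σ)Δ} Fⱼₖ dσ`. This file proves the identity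
joining the two (Lemarié-Rieusset 2016, Thm. 6.1, (6.12) ⇒ (6.11): an Oseen solution is a very
weak solution — "`⟨e^{(t-s)Δ}P∇·(u ⊗ u), φ⟩ = -⟨u ⊗ u, ∇e^{(t-s)Δ}φ⟩` since `P φ = φ` and
`e^{τΔ}` is self-adjoint"), for `Lᵖ` matrix fields `F`, `1 ≤ p ≤ ∞`, in dimension three:

* `integral_heatD1_mul_eq_neg` — **transposition of one heat derivative** (any dimension):
  `∫ (∂ᵥe^{aΔ}f) g = -∫ f (∂ᵥe^{aΔ}g)` for `f ∈ Lᵖ`, `g ∈ L^{p'}` (the kernel `∂ᵥG_a` is odd;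
  Fubini, tree `integral_convolution_mul_eq`);
* `sum_integral_heatD3_mul_inner_eq_zero_of_memLp` — **the Leray correction is a gradient**:
  `∑ᵢ ∫ (∂ᵢ∂ⱼ∂ₖ e^{sΔ} f) φᵢ = ∫ D(∂ⱼ∂ₖe^{sΔ}f)(φ) = 0` for a divergence-free test field `φ`
  (`integral_fderiv_apply_eq_zero_of_isDivFree_test`: a divergence-free test field annihilates
  the gradient of *every* smooth function — cut the potential off outside the support);
* `sum_integral_oseenHeat_mul_inner_eq_of_memLp` — **the pairing identity**:
  `∑ᵢ ∫ (𝒩_τ F)ᵢ φᵢ = -∑ᵢⱼ ∫ Fⱼᵢ ∂ⱼ(e^{τΔ}φᵢ)` (Fubini in `(x, σ)` for the Leray correction,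
  justified by the pointwise decay `|∂³e^{sΔ}f| ≤ C s^{-(3/2+3/(2p))}‖f‖_p` of
  `OseenHeatLpBounds.lean`);
* `integral_inner_sum_oseenHeat_tensor_eq_neg` — the vector form for a tensor product
  `Fⱼₖ = uⱼ vₖ`: `∫ ⟪∑ᵢ (𝒩_τ(u ⊗ v))ᵢ bᵢ, φ⟫ = -∫ ⟪v, D(e^{τΔ}φ)(u)⟫ = -∫ ⟪v, (u·∇) e^{τΔ}φ⟫`,
  i.e. exactly (minus) the transport pairing of the duality formulation with the caloric test
  field `e^{τΔ}φ`.

The bounded-data case (`Fⱼₖ ∈ L^∞`) of the pairing identity landed concurrently in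
`OseenHeatWeakDiv.lean` (`sum_integral_oseenHeat_mul_inner_eq`) and `OseenHeatPairing.lean`
(`integral_sum_oseenHeat_mul_inner_eq`); the versions here (`…_of_memLp`) cover all `Lᵖ` data,
`1 ≤ p ≤ ∞`, which is the class of the slices `u(s) ⊗ u(s) ∈ L^{3/2} ∩ L³` of Kato's scheme before
any `L^∞` information is available.

## Mathlib / tree search

Tree: `oseenHeat`, `heatD1`, `heatD2`, `heatD3`, `heatD1_eq_convolution`, `heatD2_eq_heatD1_heatD1`
(`OseenHeat.lean`); `contDiff_heatD2`, `heatD3_eq_fderiv_heatD2` (`OseenHeatWeakDiv.lean`); `integrableOn_const_mul_rpow_const_add` (`OseenHeatSemigroup.lean`);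
`UnboundedOperators.integral_convolution_mul_eq`, `integrable_kernel_mul_mul`,
`fderiv_heatKernel_neg_apply` (`HeatFlowCalculus.lean`); `VectorCalculus.IsDivFree.isWeaklyDivFree_holds`
(`VectorCalculus.lean`), `inner_gradient_eq_fderiv_apply` (`WeakGradientIBP.lean`), `cutoff`
(`WholeSpaceIBP.lean`); `exists_enorm_heatD3_le_rpow`, `continuous_heatD3`,
`aestronglyMeasurable_uncurry_heatD3_add` (`OseenHeatLpBounds.lean`);
`UnboundedOperators.contDiff_heatExtension_of_hasCompactSupport`,
`fderiv_heatExtension_of_hasCompactSupport` (`HeatKernelHeatEquation.lean`). Mathlib: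
`integral_integral_swap`, `Integrable.mul_prod`, `OrthonormalBasis.sum_repr'`,
`OrthonormalBasis.sum_inner_mul_inner`, `fderiv_inner_apply`/`HasFDerivAt.inner`.

## References

* P. G. Lemarié-Rieusset, *The Navier–Stokes Problem in the 21st Century*, CRC Press 2016,
  doi:10.1201/b19556, Thm. 6.1 ((6.12) ⇒ (6.11)) and §6.2, PDF pp. 134–137. [LemarieRieusset2016]
* E. B. Fabes, B. F. Jones, N. M. Rivière, *The initial value problem for the Navier–Stokes
  equations with data in `L^p`*, Arch. Rational Mech. Anal. 45 (1972) 222–240, Thm. 2.1.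
  [FabesJonesRiviere1972]
* T. Kato, Math. Z. 187 (1984) 471–480, (1.7), (2.3'). [Kato1984]
-/

noncomputable section

open MeasureTheory TopologicalSpace Set Function Filter Topology InnerProductSpace
open scoped ENNReal NNReal RealInnerProductSpace Convolution

namespace Literature.Analysis.FluidPDE

variable {E : Type*} [NormedAddCommGroup E] [InnerProductSpace ℝ E] [FiniteDimensional ℝ E]
  [MeasurableSpace E] [BorelSpace E]

/-! ### Transposition of one heat derivative (odd kernel) -/

section Transpose

/-- **Transposition of one derivative of the heat flow**: for conjugate exponents `p, q`,
`f ∈ Lᵖ`, `g ∈ L^q` and `a > 0`, `∫ (∂ᵥ e^{aΔ} f) g = -∫ f (∂ᵥ e^{aΔ} g)` — the kernel `∂ᵥG_a` is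
odd and `(x, y) ↦ ∂ᵥG_a(x - y) f(y) g(x)` is integrable (Young + Hölder), so Fubini applies
(Lemarié-Rieusset 2016, §6.2: the Oseen kernel is a convolution kernel). [folklore] -/
theorem integral_heatD1_mul_eq_neg {p q : ℝ≥0∞} [hpq : p.HolderConjugate q] {f g : E → ℝ}
    (hf : MemLp f p volume) (hg : MemLp g q volume) {a : ℝ} (ha : 0 < a) (v : E) :
    ∫ x, heatD1 a v f x * g x = -∫ y, f y * heatD1 a v g y := by
  have hp : 1 ≤ p := ENNReal.HolderConjugate.one_le p q
  have hq : 1 ≤ q := ENNReal.HolderConjugate.one_le q p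
  set K : E → ℝ := fun z => fderiv ℝ (UnboundedOperators.heatKernel (E := E) a) z v with hK
  have hKodd : ∀ z, K (-z) = (-1) * K z := fun z => by
    rw [hK]
    simp only [UnboundedOperators.fderiv_heatKernel_neg_apply, neg_mul, one_mul]
  have hK1 : Integrable K := UnboundedOperators.integrable_fderiv_heatKernel_apply ha v
  have hKq : MemLp K q volume := UnboundedOperators.memLp_fderiv_heatKernel_apply ha v q
  have hint := UnboundedOperators.integrable_kernel_mul_mul hK1 (p := p) (q := q) hKq hf hg
  have h := UnboundedOperators.integral_convolution_mul_eq hKodd hint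
  rw [heatD1_eq_convolution hf hp ha v, heatD1_eq_convolution hg hq ha v]
  rw [h, neg_one_mul]

end Transpose

/-! ### Divergence-free test fields annihilate all smooth gradients -/

section Gradient

/-- A smooth compactly supported divergence-free field is orthogonal to the gradient of **every**
`C¹` function (no decay needed: replace `g` by `χ g` with a cut-off `χ = 1` on the support of the
field; then the tree's `IsDivFree.isWeaklyDivFree_holds`). General-dimension form of
`integral_inner_gradient_eq_zero_of_test` (`LerayHeatTest.lean`, `ℝ³`). [folklore] -/
theorem integral_fderiv_apply_eq_zero_of_isDivFree_test {φ : E → E}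
    (hφ : FunctionSpaces.IsTestFunctionOn (⊤ : Opens E) φ) (hdiv : VectorCalculus.IsDivFree φ)
    {g : E → ℝ} (hg : ContDiff ℝ (⊤ : ℕ∞) g) :
    ∫ x, fderiv ℝ g x (φ x) = 0 := by
  obtain ⟨R₀, hR₀⟩ := hφ.hasCompactSupport.isCompact.isBounded.subset_closedBall 0
  set R : ℝ := max R₀ 0 + 1 with hR
  have hRpos : 0 < R := by rw [hR]; positivity
  have hsupp : tsupport φ ⊆ Metric.ball 0 R := hR₀.trans (Metric.closedBall_subset_ball (by
    rw [hR]; linarith [le_max_left R₀ 0]))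
  set θ : E → ℝ := fun x => cutoff R x * g x with hθ
  have hθtest : FunctionSpaces.IsTestFunctionOn (⊤ : Opens E) θ :=
    { contDiff := (contDiff_cutoff R).mul hg
      hasCompactSupport := (hasCompactSupport_cutoff hRpos).mul_right
      tsupport_subset := by simp }
  have hweak := VectorCalculus.IsDivFree.isWeaklyDivFree_holds hdiv
    (hφ.contDiff.of_le (by exact_mod_cast le_top)) θ hθtest
  rw [← hweak]
  refine integral_congr_ae (Eventually.of_forall fun x => ?_)
  dsimp only
  by_cases hx : x ∈ tsupport φ
  · have hball : Metric.ball (0 : E) R ∈ 𝓝 x := Metric.isOpen_ball.mem_nhds (hsupp hx)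
    have heq : θ =ᶠ[𝓝 x] g := by
      filter_upwards [hball] with y hy
      simp only [hθ, cutoff_eq_one hRpos (le_of_lt (mem_ball_zero_iff.1 hy)), one_mul]
    rw [inner_gradient_eq_fderiv_apply, heq.fderiv_eq]
  · rw [image_eq_zero_of_notMem_tsupport hx, inner_zero_left, map_zero]

end Gradient

/-! ### The Leray correction pairs to zero with divergence-free test fields -/

section Leray

omit [MeasurableSpace E] [BorelSpace E] in
/-- Frame expansion of a derivative: `∑ᵢ Dg(x)(bᵢ) ⟪w, bᵢ⟫ = Dg(x)(w)`. [folklore] -/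
theorem sum_fderiv_apply_mul_inner (g : E → ℝ) (x w : E) :
    ∑ i, fderiv ℝ g x (stdOrthonormalBasis ℝ E i) * ⟪w, stdOrthonormalBasis ℝ E i⟫ =
      fderiv ℝ g x w := by
  set b := stdOrthonormalBasis ℝ E
  have hw : ∑ i, ⟪w, b i⟫ • b i = w := by
    have := b.sum_repr' w
    simpa only [real_inner_comm] using this
  conv_rhs => rw [← hw]
  rw [map_sum]
  refine Finset.sum_congr rfl fun i _ => ?_
  rw [map_smul, smul_eq_mul, mul_comm]

/-- **The Leray correction is orthogonal to divergence-free test fields**: for `f ∈ Lᵖ`, `s > 0`,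
frame indices `j, k` and a divergence-free test field `φ`,
`∑ᵢ ∫ (∂ᵢ∂ⱼ∂ₖ e^{sΔ} f)(x) ⟪φ(x), bᵢ⟫ dx = ∫ D(∂ⱼ∂ₖe^{sΔ}f)(φ) = 0` — the `i`-th third derivative is
the `i`-th partial of the smooth potential `∂ⱼ∂ₖ e^{sΔ} f` (Lemarié-Rieusset 2016, Thm. 6.1:
`P φ = φ` kills the gradient part of the Oseen kernel). [cite: LemarieRieusset2016, Thm. 6.1 ((6.12) ⇒ (6.11))] -/
theorem sum_integral_heatD3_mul_inner_eq_zero_of_memLp {p : ℝ≥0∞} (hp : 1 ≤ p) {f : E → ℝ}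
    (hf : MemLp f p volume) {s : ℝ} (hs : 0 < s) (j k : Fin (Module.finrank ℝ E)) {φ : E → E}
    (hφ : FunctionSpaces.IsTestFunctionOn (⊤ : Opens E) φ) (hdiv : VectorCalculus.IsDivFree φ) :
    ∑ i, ∫ x, heatD3 s (stdOrthonormalBasis ℝ E i) (stdOrthonormalBasis ℝ E j)
      (stdOrthonormalBasis ℝ E k) f x * ⟪φ x, stdOrthonormalBasis ℝ E i⟫ = 0 := by
  set b := stdOrthonormalBasis ℝ E
  set g : E → ℝ := heatD2 s (b j) (b k) f with hg
  have hgs : ContDiff ℝ (⊤ : ℕ∞) g := contDiff_heatD2 hf hp hs (b j) (b k)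
  have hint : ∀ i, Integrable (fun x => heatD3 s (b i) (b j) (b k) f x * ⟪φ x, b i⟫) volume := by
    intro i
    refine Continuous.integrable_of_hasCompactSupport ?_ ?_
    · exact (continuous_heatD3 hp hf hs (b i) (b j) (b k)).mul
        (hφ.contDiff.continuous.inner continuous_const)
    · exact (hφ.hasCompactSupport.comp_left (g := fun w : E => ⟪w, b i⟫)
        (inner_zero_left _)).mul_left
  rw [← integral_finsetSum _ fun i _ => hint i]
  have hpt : ∀ x, ∑ i, heatD3 s (b i) (b j) (b k) f x * ⟪φ x, b i⟫ = fderiv ℝ g x (φ x) := by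
    intro x
    simp only [b, hg]
    exact sum_fderiv_apply_mul_inner _ x (φ x)
  simp_rw [hpt]
  exact integral_fderiv_apply_eq_zero_of_isDivFree_test hφ hdiv hgs

end Leray

/-! ### The pairing identity -/

section Pairing

variable (hE : Module.finrank ℝ E = 3)
include hE

/-- **Integrability on `E × (0, ∞)` of the tested Leray integrand**
`(x, σ) ↦ ∂ᵢ∂ⱼ∂ₖ e^{(τ+σ)Δ} f (x) · h(x)` for `f ∈ Lᵖ`, `τ > 0` and an integrable weight `h` (here a component of a test field): the pointwise decay
`|∂³e^{sΔ}f| ≤ C s^{-(3/2+3/(2p))} ‖f‖_p` (`OseenHeatLpBounds.lean`) is integrable in `σ` and `h`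
is integrable in `x`. [folklore] -/
theorem integrable_heatD3_add_mul {p : ℝ≥0∞} (hp : 1 ≤ p) {f : E → ℝ} (hf : MemLp f p volume)
    {τ : ℝ} (hτ : 0 < τ) (i j k : Fin (Module.finrank ℝ E)) {h : E → ℝ} (hh : Integrable h volume) :
    Integrable (uncurry fun (x : E) (σ : ℝ) =>
      heatD3 (τ + σ) (stdOrthonormalBasis ℝ E i) (stdOrthonormalBasis ℝ E j)
        (stdOrthonormalBasis ℝ E k) f x * h x)
      ((volume : Measure E).prod (volume.restrict (Ioi (0 : ℝ)))) := by
  set b := stdOrthonormalBasis ℝ E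
  obtain ⟨C, hC⟩ := exists_enorm_heatD3_le_rpow hE hp
  set e : ℝ := 3 / 2 + 3 / 2 * (1 / p).toReal with he
  have he1 : 1 < e := by
    rw [he]
    have : 0 ≤ (1 / p).toReal := ENNReal.toReal_nonneg
    linarith
  -- the real constant `A = C ‖f‖_p`
  set A : ℝ := (C : ℝ) * (eLpNorm f p volume).toReal with hA
  have hA0 : 0 ≤ A := by rw [hA]; positivity
  have hbound : ∀ σ ∈ Ioi (0 : ℝ), ∀ x, ‖heatD3 (τ + σ) (b i) (b j) (b k) f x‖ ≤ A * (τ + σ) ^ (-e) := by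
    intro σ hσ x
    have hs : 0 < τ + σ := by have : (0 : ℝ) < σ := hσ; linarith
    have h := hC f hf (τ + σ) hs (b i) (b j) (b k) (norm_stdOrthonormalBasis_le_one i)
      (norm_stdOrthonormalBasis_le_one j) (norm_stdOrthonormalBasis_le_one k) x
    have hfin : (C : ℝ≥0∞) * ENNReal.ofReal ((τ + σ) ^ (-e)) * eLpNorm f p volume ≠ ⊤ :=
      (ENNReal.mul_lt_top (ENNReal.mul_lt_top ENNReal.coe_lt_top ENNReal.ofReal_lt_top)
        hf.2).ne
    have h' := (ENNReal.toReal_le_toReal enorm_ne_top hfin).2 h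
    rw [toReal_enorm] at h'
    refine h'.trans (le_of_eq ?_)
    rw [ENNReal.toReal_mul, ENNReal.toReal_mul, ENNReal.coe_toReal,
      ENNReal.toReal_ofReal (Real.rpow_nonneg hs.le _), hA]
    ring
  -- measurability
  have hmeas : AEStronglyMeasurable (uncurry fun (x : E) (σ : ℝ) =>
      heatD3 (τ + σ) (b i) (b j) (b k) f x * h x)
      ((volume : Measure E).prod (volume.restrict (Ioi (0 : ℝ)))) := by
    have h1 := aestronglyMeasurable_uncurry_heatD3_add hp hf hτ (b i) (b j) (b k)
    have h2 : AEStronglyMeasurable (fun z : E × ℝ => h z.1)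
        ((volume : Measure E).prod (volume.restrict (Ioi (0 : ℝ)))) := hh.1.comp_fst
    exact h1.mul h2
  -- domination by a product of integrable functions
  have hdom : Integrable (fun z : E × ℝ => ‖h z.1‖ * (A * (τ + z.2) ^ (-e)))
      ((volume : Measure E).prod (volume.restrict (Ioi (0 : ℝ)))) := by
    have hσ : Integrable (fun σ : ℝ => A * (τ + σ) ^ (-e)) (volume.restrict (Ioi (0 : ℝ))) :=
      integrableOn_const_mul_rpow_const_add hτ he1 A
    exact hh.norm.mul_prod hσ
  refine hdom.mono' hmeas ?_
  have hae : ∀ᵐ z ∂((volume : Measure E).prod (volume.restrict (Ioi (0 : ℝ)))), z.2 ∈ Ioi (0 : ℝ) :=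
    Measure.quasiMeasurePreserving_snd.ae (ae_restrict_mem measurableSet_Ioi)
  filter_upwards [hae] with z hz
  simp only [uncurry, norm_mul]
  calc ‖heatD3 (τ + z.2) (b i) (b j) (b k) f z.1‖ * ‖h z.1‖
      ≤ A * (τ + z.2) ^ (-e) * ‖h z.1‖ := by
        gcongr
        exact hbound z.2 hz z.1
    _ = ‖h z.1‖ * (A * (τ + z.2) ^ (-e)) := by ring

/-- **The pairing identity for the Oseen–heat operator** (dimension three): for an `Lᵖ` matrix
field `F`, `1 ≤ p ≤ ∞`, `τ > 0`, and a smooth compactly supported divergence-free field `φ` with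
frame components `φᵢ = ⟪φ, bᵢ⟫`,
`∑ᵢ ∫ (𝒩_τ F)ᵢ φᵢ = -∑ᵢⱼ ∫ Fⱼᵢ ∂ⱼ(e^{τΔ} φᵢ)`:
the first-order terms transpose (`integral_heatD1_mul_eq_neg`), and the Leray corrections
contribute nothing (Fubini in `(x, σ)`, then `sum_integral_heatD3_mul_inner_eq_zero_of_memLp` slice by
slice) — "`⟨e^{τΔ}P∇·F, φ⟩ = -⟨F, ∇e^{τΔ}φ⟩` for divergence-free `φ`" (Lemarié-Rieusset 2016,
Thm. 6.1, (6.12) ⇒ (6.11)). [cite: LemarieRieusset2016, Thm. 6.1 ((6.12) ⇒ (6.11))] -/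
theorem sum_integral_oseenHeat_mul_inner_eq_of_memLp {p q : ℝ≥0∞} [hpq : p.HolderConjugate q]
    {F : Fin (Module.finrank ℝ E) → Fin (Module.finrank ℝ E) → E → ℝ}
    (hF : ∀ j k, MemLp (F j k) p volume) {τ : ℝ} (hτ : 0 < τ) {φ : E → E}
    (hφ : FunctionSpaces.IsTestFunctionOn (⊤ : Opens E) φ) (hdiv : VectorCalculus.IsDivFree φ) :
    ∑ i, ∫ x, oseenHeat τ F i x * ⟪φ x, stdOrthonormalBasis ℝ E i⟫ =
      -∑ i, ∑ j, ∫ y, F j i y *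
        heatD1 τ (stdOrthonormalBasis ℝ E j) (fun x => ⟪φ x, stdOrthonormalBasis ℝ E i⟫) y := by
  have hp : 1 ≤ p := ENNReal.HolderConjugate.one_le p q
  set b := stdOrthonormalBasis ℝ E
  -- the components of the test field
  set φc : Fin (Module.finrank ℝ E) → E → ℝ := fun i x => ⟪φ x, b i⟫ with hφc
  have hφc_cont : ∀ i, Continuous (φc i) := fun i => hφ.contDiff.continuous.inner continuous_const
  have hφc_supp : ∀ i, HasCompactSupport (φc i) := fun i =>
    hφ.hasCompactSupport.comp_left (g := fun w : E => ⟪w, b i⟫) (inner_zero_left _)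
  have hφc_int : ∀ i, Integrable (φc i) volume := fun i =>
    (hφc_cont i).integrable_of_hasCompactSupport (hφc_supp i)
  have hφc_mem : ∀ i (r : ℝ≥0∞), MemLp (φc i) r volume := fun i r =>
    (hφc_cont i).memLp_of_hasCompactSupport (hφc_supp i)
  -- integrability of the pieces against `φᵢ`
  have hint1 : ∀ i j, Integrable (fun x => heatD1 τ (b j) (F j i) x * φc i x) volume := by
    intro i j
    refine Continuous.integrable_of_hasCompactSupport ?_ (hφc_supp i).mul_left
    exact (contDiff_heatD1 (hF j i) hp hτ (b j) (n := 0)).continuous.mul (hφc_cont i)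
  have hint3 : ∀ i j k, Integrable (uncurry fun (x : E) (σ : ℝ) =>
      heatD3 (τ + σ) (b i) (b j) (b k) (F j k) x * φc i x)
      ((volume : Measure E).prod (volume.restrict (Ioi (0 : ℝ)))) := fun i j k =>
    integrable_heatD3_add_mul hE hp (hF j k) hτ i j k (hφc_int i)
  have hint3x : ∀ i j k, Integrable (fun x => (∫ σ in Ioi (0 : ℝ),
      heatD3 (τ + σ) (b i) (b j) (b k) (F j k) x) * φc i x) volume := by
    intro i j k
    have h := (hint3 i j k).integral_prod_left
    refine h.congr (Eventually.of_forall fun x => ?_)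
    simp only [uncurry]
    exact integral_mul_const _ _
  -- expand `(𝒩_τ F)ᵢ φᵢ`
  have hexpand : ∀ i, ∫ x, oseenHeat τ F i x * φc i x =
      (∑ j, ∫ x, heatD1 τ (b j) (F j i) x * φc i x) +
        ∑ j, ∑ k, ∫ x, (∫ σ in Ioi (0 : ℝ), heatD3 (τ + σ) (b i) (b j) (b k) (F j k) x) * φc i x := by
    intro i
    have hpt : ∀ x, oseenHeat τ F i x * φc i x =
        (∑ j, heatD1 τ (b j) (F j i) x * φc i x) +
          ∑ j, ∑ k, (∫ σ in Ioi (0 : ℝ), heatD3 (τ + σ) (b i) (b j) (b k) (F j k) x) * φc i x := by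
      intro x
      simp only [oseenHeat, b, add_mul, Finset.sum_mul]
    simp_rw [hpt]
    rw [integral_add (integrable_finsetSum _ fun j _ => hint1 i j)
      (integrable_finsetSum _ fun j _ => integrable_finsetSum _ fun k _ => hint3x i j k),
      integral_finsetSum _ fun j _ => hint1 i j,
      integral_finsetSum _ fun j _ => integrable_finsetSum _ fun k _ => hint3x i j k]
    congr 1
    exact Finset.sum_congr rfl fun j _ => integral_finsetSum _ fun k _ => hint3x i j k
  -- the first-order terms transpose
  have hfirst : ∀ i j, ∫ x, heatD1 τ (b j) (F j i) x * φc i x =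
      -∫ y, F j i y * heatD1 τ (b j) (φc i) y := fun i j =>
    integral_heatD1_mul_eq_neg (hF j i) (hφc_mem i q) hτ (b j)
  -- the Leray corrections vanish: Fubini, then slice by slice
  have hleray : ∀ j k, ∑ i, ∫ x, (∫ σ in Ioi (0 : ℝ),
      heatD3 (τ + σ) (b i) (b j) (b k) (F j k) x) * φc i x = 0 := by
    intro j k
    have hswap : ∀ i, ∫ x, (∫ σ in Ioi (0 : ℝ), heatD3 (τ + σ) (b i) (b j) (b k) (F j k) x) * φc i x =
        ∫ σ in Ioi (0 : ℝ), ∫ x, heatD3 (τ + σ) (b i) (b j) (b k) (F j k) x * φc i x := by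
      intro i
      have h1 : ∀ x, (∫ σ in Ioi (0 : ℝ), heatD3 (τ + σ) (b i) (b j) (b k) (F j k) x) * φc i x =
          ∫ σ in Ioi (0 : ℝ), heatD3 (τ + σ) (b i) (b j) (b k) (F j k) x * φc i x := fun x =>
        (integral_mul_const _ _).symm
      simp_rw [h1]
      exact integral_integral_swap (hint3 i j k)
    simp_rw [hswap]
    have hintσ : ∀ i, Integrable (fun σ => ∫ x, heatD3 (τ + σ) (b i) (b j) (b k) (F j k) x * φc i x)
        (volume.restrict (Ioi (0 : ℝ))) := fun i => (hint3 i j k).integral_prod_right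
    rw [← integral_finsetSum _ fun i _ => hintσ i]
    refine setIntegral_eq_zero_of_forall_eq_zero fun σ hσ => ?_
    have hs : 0 < τ + σ := by have : (0 : ℝ) < σ := hσ; linarith
    exact sum_integral_heatD3_mul_inner_eq_zero_of_memLp hp (hF j k) hs j k hφ hdiv
  -- assemble
  calc ∑ i, ∫ x, oseenHeat τ F i x * φc i x
      = ∑ i, ((∑ j, ∫ x, heatD1 τ (b j) (F j i) x * φc i x) +
          ∑ j, ∑ k, ∫ x, (∫ σ in Ioi (0 : ℝ), heatD3 (τ + σ) (b i) (b j) (b k) (F j k) x) * φc i x) :=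
        Finset.sum_congr rfl fun i _ => hexpand i
    _ = (∑ i, ∑ j, ∫ x, heatD1 τ (b j) (F j i) x * φc i x) +
          ∑ j, ∑ k, ∑ i, ∫ x, (∫ σ in Ioi (0 : ℝ),
            heatD3 (τ + σ) (b i) (b j) (b k) (F j k) x) * φc i x := by
        rw [Finset.sum_add_distrib]
        congr 1
        rw [Finset.sum_comm]
        exact Finset.sum_congr rfl fun j _ => Finset.sum_comm
    _ = (∑ i, ∑ j, ∫ x, heatD1 τ (b j) (F j i) x * φc i x) + 0 := by
        congr 1
        exact Finset.sum_eq_zero fun j _ => Finset.sum_eq_zero fun k _ => hleray j k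
    _ = -∑ i, ∑ j, ∫ y, F j i y * heatD1 τ (b j) (φc i) y := by
        rw [add_zero, ← Finset.sum_neg_distrib]
        refine Finset.sum_congr rfl fun i _ => ?_
        rw [← Finset.sum_neg_distrib]
        exact Finset.sum_congr rfl fun j _ => hfirst i j

end Pairing

/-! ### Vector form for a tensor product `F = u ⊗ v` -/

section Tensor

variable (hE : Module.finrank ℝ E = 3)

/-- **Components of the caloric test field**: for a `C¹` compactly supported `φ : E → E`,
`∂ⱼ(e^{τΔ} ⟪φ, bᵢ⟫)(y) = ⟪D(e^{τΔ}φ)(y)(bⱼ), bᵢ⟫` — the heat flow commutes with the (continuous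
linear) coordinate maps and with derivatives of compactly supported fields. [folklore] -/
theorem heatD1_inner_const_eq (φ : E → E) (hφ : ContDiff ℝ 1 φ) (hc : HasCompactSupport φ)
    {τ : ℝ} (i j : Fin (Module.finrank ℝ E)) (y : E) :
    heatD1 τ (stdOrthonormalBasis ℝ E j) (fun x => ⟪φ x, stdOrthonormalBasis ℝ E i⟫) y =
      ⟪fderiv ℝ (UnboundedOperators.heatExtension φ τ) y (stdOrthonormalBasis ℝ E j),
        stdOrthonormalBasis ℝ E i⟫ := by
  -- the coordinate map as a continuous linear functional
  set L : E →L[ℝ] ℝ := (innerSL ℝ (stdOrthonormalBasis ℝ E i) : E →L[ℝ] ℝ) with hL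
  have hLapply : ∀ w : E, L w = ⟪w, stdOrthonormalBasis ℝ E i⟫ := fun w => by
    rw [hL, innerSL_apply_apply, real_inner_comm]
  -- `e^{τΔ}(L ∘ φ) = L ∘ e^{τΔ}φ`
  have hcomm : (UnboundedOperators.heatExtension (fun x => ⟪φ x, stdOrthonormalBasis ℝ E i⟫) τ) =
      fun x => L (UnboundedOperators.heatExtension φ τ x) := by
    funext x
    rw [← UnboundedOperators.heatExtension_clm_comp L hφ.continuous hc τ x]
    congr 1
    funext w
    exact (hLapply (φ w)).symm
  unfold heatD1
  rw [hcomm]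
  have hdiff : DifferentiableAt ℝ (UnboundedOperators.heatExtension φ τ) y :=
    ((UnboundedOperators.contDiff_heatExtension_of_hasCompactSupport hφ hc τ).differentiable
      one_ne_zero y)
  have hcomp : HasFDerivAt (fun x => L (UnboundedOperators.heatExtension φ τ x))
      ((L : E →L[ℝ] ℝ).comp (fderiv ℝ (UnboundedOperators.heatExtension φ τ) y)) y :=
    L.hasFDerivAt.comp y hdiff.hasFDerivAt
  rw [hcomp.fderiv, ContinuousLinearMap.comp_apply, hLapply]

omit [MeasurableSpace E] [BorelSpace E] in
/-- Frame recombination: `∑ᵢⱼ ⟪u, bⱼ⟫ ⟪v, bᵢ⟫ ⟪T bⱼ, bᵢ⟫ = ⟪v, T u⟫` for a linear map `T`.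
[folklore] -/
theorem sum_sum_inner_mul_inner_mul_inner_apply (T : E →L[ℝ] E) (u v : E) :
    ∑ i, ∑ j, ⟪u, stdOrthonormalBasis ℝ E j⟫ * ⟪v, stdOrthonormalBasis ℝ E i⟫ *
        ⟪T (stdOrthonormalBasis ℝ E j), stdOrthonormalBasis ℝ E i⟫ = ⟪v, T u⟫ := by
  have hu : ∑ j, ⟪u, stdOrthonormalBasis ℝ E j⟫ • stdOrthonormalBasis ℝ E j = u := by
    have := (stdOrthonormalBasis ℝ E).sum_repr' u
    simpa only [real_inner_comm] using this
  have h2 : ∀ i, ⟪T u, stdOrthonormalBasis ℝ E i⟫ =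
      ∑ j, ⟪u, stdOrthonormalBasis ℝ E j⟫ * ⟪T (stdOrthonormalBasis ℝ E j), stdOrthonormalBasis ℝ E i⟫ := by
    intro i
    conv_lhs => rw [← hu]
    rw [map_sum, sum_inner]
    refine Finset.sum_congr rfl fun j _ => ?_
    rw [map_smul, real_inner_smul_left]
  have h1 : ∀ i, ∑ j, ⟪u, stdOrthonormalBasis ℝ E j⟫ * ⟪v, stdOrthonormalBasis ℝ E i⟫ *
      ⟪T (stdOrthonormalBasis ℝ E j), stdOrthonormalBasis ℝ E i⟫ =
      ⟪v, stdOrthonormalBasis ℝ E i⟫ * ⟪T u, stdOrthonormalBasis ℝ E i⟫ := by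
    intro i
    rw [h2 i, Finset.mul_sum]
    refine Finset.sum_congr rfl fun j _ => ?_
    ring
  simp_rw [h1]
  have h3 := (stdOrthonormalBasis ℝ E).sum_inner_mul_inner v (T u)
  calc ∑ i, ⟪v, stdOrthonormalBasis ℝ E i⟫ * ⟪T u, stdOrthonormalBasis ℝ E i⟫
      = ∑ i, ⟪v, stdOrthonormalBasis ℝ E i⟫ * ⟪stdOrthonormalBasis ℝ E i, T u⟫ :=
        Finset.sum_congr rfl fun i _ => by rw [real_inner_comm (stdOrthonormalBasis ℝ E i) (T u)]
    _ = ⟪v, T u⟫ := h3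

include hE in
/-- **The Oseen–heat operator of a tensor product tested against a divergence-free field**
(dimension three): for `u, v : E → E` with the products `⟪u, bⱼ⟫⟪v, bₖ⟫ ∈ Lᵖ`, `1 ≤ p ≤ ∞`,
`τ > 0`, and a smooth compactly supported divergence-free `φ`,
`∫ ⟪∑ᵢ (𝒩_τ(u ⊗ v))ᵢ bᵢ, φ⟫ = -∫ ⟪v, D(e^{τΔ}φ)(u)⟫ = -∫ ⟪v, (u·∇) e^{τΔ}φ⟫` — the transport
pairing of the tree's duality formulation with the caloric test field (Lemarié-Rieusset 2016,
Thm. 6.1; Fabes–Jones–Rivière 1972, Thm. 2.1; Kato 1984, (1.7) tested with `φ`).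
[cite: LemarieRieusset2016, Thm. 6.1 ((6.12) ⇒ (6.11))] [cite: FabesJonesRiviere1972, Thm. 2.1] -/
theorem integral_inner_sum_oseenHeat_tensor_eq_neg {p q : ℝ≥0∞} [hpq : p.HolderConjugate q]
    {u v : E → E}
    (huv : ∀ j k, MemLp (fun y => ⟪u y, stdOrthonormalBasis ℝ E j⟫ * ⟪v y, stdOrthonormalBasis ℝ E k⟫)
      p volume)
    {τ : ℝ} (hτ : 0 < τ) {φ : E → E}
    (hφ : FunctionSpaces.IsTestFunctionOn (⊤ : Opens E) φ) (hdiv : VectorCalculus.IsDivFree φ)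
    (hint : ∀ i, Integrable (fun x => oseenHeat τ (fun j k y =>
      ⟪u y, stdOrthonormalBasis ℝ E j⟫ * ⟪v y, stdOrthonormalBasis ℝ E k⟫) i x *
        ⟪φ x, stdOrthonormalBasis ℝ E i⟫) volume) :
    ∫ x, ⟪∑ i, oseenHeat τ (fun j k y =>
        ⟪u y, stdOrthonormalBasis ℝ E j⟫ * ⟪v y, stdOrthonormalBasis ℝ E k⟫) i x •
          stdOrthonormalBasis ℝ E i, φ x⟫ =
      -∫ y, ⟪v y, fderiv ℝ (UnboundedOperators.heatExtension φ τ) y (u y)⟫ := by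
  have hφ1 : ContDiff ℝ 1 φ := hφ.contDiff.of_le (by exact_mod_cast le_top)
  have hq : 1 ≤ q := ENNReal.HolderConjugate.one_le q p
  -- left-hand side as a sum of component pairings
  have hL : ∫ x, ⟪∑ i, oseenHeat τ (fun j k y =>
        ⟪u y, stdOrthonormalBasis ℝ E j⟫ * ⟪v y, stdOrthonormalBasis ℝ E k⟫) i x •
          stdOrthonormalBasis ℝ E i, φ x⟫ =
      ∑ i, ∫ x, oseenHeat τ (fun j k y =>
        ⟪u y, stdOrthonormalBasis ℝ E j⟫ * ⟪v y, stdOrthonormalBasis ℝ E k⟫) i x *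
          ⟪φ x, stdOrthonormalBasis ℝ E i⟫ := by
    rw [← integral_finsetSum _ fun i _ => hint i]
    refine integral_congr_ae (Eventually.of_forall fun x => ?_)
    dsimp only
    rw [sum_inner]
    refine Finset.sum_congr rfl fun i _ => ?_
    rw [real_inner_smul_left, real_inner_comm]
  rw [hL, sum_integral_oseenHeat_mul_inner_eq_of_memLp (q := q) hE huv hτ hφ hdiv]
  congr 1
  simp only [heatD1_inner_const_eq φ hφ1 hφ.hasCompactSupport]
  -- integrability of each summand `y ↦ uⱼ vᵢ ⟪Dψ(bⱼ), bᵢ⟫` (`Lᵖ · L^q`)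
  have hDψ_mem : ∀ i j, MemLp (fun y => ⟪fderiv ℝ (UnboundedOperators.heatExtension φ τ) y
      (stdOrthonormalBasis ℝ E j), stdOrthonormalBasis ℝ E i⟫) q volume := by
    intro i j
    have hcoord : MemLp (fun y => fderiv ℝ (UnboundedOperators.heatExtension φ τ) y
        (stdOrthonormalBasis ℝ E j)) q volume :=
      UnboundedOperators.memLp_fderiv_heatExtension_apply
        (hφ.contDiff.continuous.memLp_of_hasCompactSupport hφ.hasCompactSupport (p := q)) hq hτ _
    exact hcoord.inner_const _
  have hsummand : ∀ i j, Integrable (fun y => ⟪u y, stdOrthonormalBasis ℝ E j⟫ *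
      ⟪v y, stdOrthonormalBasis ℝ E i⟫ * ⟪fderiv ℝ (UnboundedOperators.heatExtension φ τ) y
        (stdOrthonormalBasis ℝ E j), stdOrthonormalBasis ℝ E i⟫) volume := by
    intro i j
    have h := MemLp.mul' (r := 1) (hDψ_mem i j) (huv j i)
    rw [memLp_one_iff_integrable] at h
    exact h
  have hinner : ∀ i, ∑ j, ∫ y, ⟪u y, stdOrthonormalBasis ℝ E j⟫ *
      ⟪v y, stdOrthonormalBasis ℝ E i⟫ * ⟪fderiv ℝ (UnboundedOperators.heatExtension φ τ) y
        (stdOrthonormalBasis ℝ E j), stdOrthonormalBasis ℝ E i⟫ =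
      ∫ y, ∑ j, ⟪u y, stdOrthonormalBasis ℝ E j⟫ *
      ⟪v y, stdOrthonormalBasis ℝ E i⟫ * ⟪fderiv ℝ (UnboundedOperators.heatExtension φ τ) y
        (stdOrthonormalBasis ℝ E j), stdOrthonormalBasis ℝ E i⟫ := fun i =>
    (integral_finsetSum _ fun j _ => hsummand i j).symm
  rw [Finset.sum_congr rfl fun i _ => hinner i,
    ← integral_finsetSum _ fun i _ => integrable_finsetSum _ fun j _ => hsummand i j]
  refine integral_congr_ae (Eventually.of_forall fun y => ?_)
  exact sum_sum_inner_mul_inner_mul_inner_apply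
    (fderiv ℝ (UnboundedOperators.heatExtension φ τ) y) (u y) (v y)

end Tensor

end Literature.Analysis.FluidPDE
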